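import Summits.BirchSwinnertonDyer.BirchSwinnertonDyer.Theorems.PrintCf2RamifiedOffTYZPartnerShaLevelTwoR1
import Literature.NumberTheory.EllipticCurves.BinaryQuarticStabilizerTorsion
import Literature.NumberTheory.EllipticCurves.IsogenyMordellWeilRankProofs
import HarnessLib

/-!
# Crux `PrintCf2.RamifiedOffTYZOfFacts` (stmt-BirchSwinnertonDyer-20509), line `offtyz-v7`, LEAD cycle 24 (cruxlead-20509 g23), part 5:
# THE PARTNER CONDITION IN 2-SELMER CURRENCY — `Ш(A_n)[2] = 0 ⟺ #Sel₂(A_n/ℚ) = 4` — and the HEADLINE on R1/R2 as «`#Sel₂(A_n) = 4`»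

THEOREMS ONLY (no `def`, no named fact, no `sorry`), `--supports stmt-BirchSwinnertonDyer-20509`.  The HEADLINE of cycle 21 (g20, `…PartnerShaRigidity`)
and its R1/R2 instances (cycle 21 part 6, cycle 24 part 4) carry the partner condition as «every `2`-torsion class of `Ш(A_n/ℚ)` is trivial».  The
lineage's census (g15 `Lines/offtyz_v7_SpecialStratum.md` §1(c), 1568 cases) and any `2`-descent engine (Ouyang–Zhang 2015 §2, the paper path for the
partner laws F1) speak instead of the DIMENSION `dim_𝔽₂ Sel₂(A_n/ℚ)`.  This part proves the dictionary: for square-free `n` with `rank E_n(ℚ) = 1`,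
**`Ш(A_n)[2] = 0 ⟺ #Sel₂(A_n/ℚ) = 4`** (`#Sel₂(A_n) = 2^{rank}·#A_n(ℚ)[2]·#Ш(A_n)[2]`, Silverman X.4.2, with `rank A_n = rank E_n` by isogeny invariance and
`A_n(ℚ)[2] = {O, (0,0)}` since `X² + 4n²` has no rational root), and restates the HEADLINE on R1 and R2 in that currency.

* §17 `twoIsogenyCodomain_congruentNumberCurve` (`A_n = [0,0,0,4n²,0]`), `natCard_torsionBy_two_partner` (`#A_n(ℚ)[2] = 2`), `mordellWeilRank_partner`
  (`rank A_n(ℚ) = rank E_n(ℚ)`), `natCard_selmerTwo_partner` (`#Sel₂(A_n) = 2^{rank E_n} · 2 · #Ш(A_n)[2]`), `partner_sha_two_trivial_iff_natCard`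
  (`Ш(A_n)[2] = 0 ⟺ #Ш(A_n)[2] = 1`), ★ `partner_sha_two_trivial_iff_natCard_selmerTwo` (rank `1`: `⟺ #Sel₂(A_n) = 4`).
* §18 ★ `natCard_selmerTwo_partner_eq_four_iff_R1`, ★ `natCard_selmerTwo_partner_eq_four_iff_R2`: on R1 (resp. R2) with `ord_{s=1} L(E_n, s) = 1`,
  `#Sel₂(E_n) = 2⁵`, granted GZK + `exists_casselsTate_pairing_adjoint ℚ`: **`#Sel₂(A_n/ℚ) = 4 ⟺ ρ(n) ≠ 0 ∧ #Sel₄(E_n) = 2⁶`** — the census sentence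
  «`dim Sel₂(A_n/ℚ) = 2 ⟺ ρ = 1` on G» (SpecialStratum §1(b)) as a theorem on both odd two-prime sectors; `natCard_selmerTwo_partner_ne_four_of_not_selmerFour`
  (T3 in this currency: outside the jump-one class `#Sel₂(A_n) ≠ 4`).
Beyond-print theorem: NO (descent bookkeeping).  BSD is not proved by any of this; C⁺ (23431) and the crux stay OPEN.

References: [cite: SilvermanAEC2009, Thm. X.4.2, III.4 Example 4.5, III.6.2]; [cite: MilneADT2006, proof of Thm. I.7.3 (p. 97), Ch. I Thm. 6.13(a)];
[cite: TianYuanZhang2017, §1 (A_n, ρ(n))]; [cite: Darmon2004, Thm. 3.22]; tree: `SecondDescentShaExponentProofs`, `BinaryQuarticStabilizerTorsion`,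
`IsogenyMordellWeilRankProofs`, cycle 21/24 `…PartnerSha*`.
-/

noncomputable section

open scoped Classical

open WeierstrassCurve Literature.NumberTheory.EllipticCurves Literature.NumberTheory.EllipticCurves.Rank1Residual
  Literature.NumberTheory.EllipticCurves.TianYuanZhang2017

set_option autoImplicit false

namespace Summit.BirchSwinnertonDyer.PrintCf2.PartnerSha

/-! ## §17 `#Sel₂(A_n/ℚ) = 2^{rank E_n(ℚ)} · 2 · #Ш(A_n)[2]` and the dictionary `Ш(A_n)[2] = 0 ⟺ #Sel₂(A_n) = 4` -/

section Count

variable {n : ℕ}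

/-- The partner as a literal short Weierstrass equation: `A_n = E_n' = [0, 0, 0, 4n², 0] : Y² = X³ + 4n²X`.
[cite: SilvermanAEC2009, III.4 Example 4.5] [cite: TianYuanZhang2017, §1 (A_n)] -/
theorem twoIsogenyCodomain_congruentNumberCurve (n : ℕ) :
    (congruentNumberCurve n).twoIsogenyCodomain = (⟨0, 0, 0, 4 * (n : ℚ) ^ 2, 0⟩ : WeierstrassCurve ℚ) := by
  simp only [twoIsogenyCodomain, congruentNumberCurve]
  ext <;> simp

/-- **`#A_n(ℚ)[2] = 2`** (`n ≠ 0`): the `2`-division cubic of `Y² = X³ + 4n²X` is `X(X² + 4n²)`, whose only rational root is `0`.  Stated for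
EVERY `DecidableEq ℚ` behind the group law on `A_n(ℚ)` (the generic descent lemmas carry the classical one, `ℚ`-specific files `ℚ`'s own; the
instance is a subsingleton). [cite: SilvermanAEC2009, III.4 Example 4.5] -/
theorem natCard_torsionBy_two_partner (hn : n ≠ 0) [inst : DecidableEq ℚ] :
    Nat.card (@AddSubgroup.torsionBy _
      (@Affine.Point.instAddCommGroup ℚ _ (congruentNumberCurve n).twoIsogenyCodomain.toAffine inst) (2 : ℤ)) = 2 := by
  haveI := isElliptic_congruentNumberCurve hn
  obtain rfl : inst = fun a b => Classical.propDecidable (a = b) := Subsingleton.elim _ _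
  have h := natCard_torsionBy_two_eq (congruentNumberCurve n).twoIsogenyCodomain (two_ne_zero (α := ℚ))
  have hset : {x : ℚ | (congruentNumberCurve n).twoIsogenyCodomain.twoTorsionPolynomial.toPoly.IsRoot x} = {0} := by
    ext x
    rw [Set.mem_setOf_eq, twoIsogenyCodomain_congruentNumberCurve, isRoot_twoTorsionPolynomial_short_iff two_ne_zero,
      Set.mem_singleton_iff]
    constructor
    · intro h0
      have hx : x * (x ^ 2 + 4 * (n : ℚ) ^ 2) = 0 := by linear_combination h0
      rcases mul_eq_zero.mp hx with h1 | h1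
      · exact h1
      · exfalso
        have hn' : (0 : ℚ) < (n : ℚ) ^ 2 := by
          have : (n : ℚ) ≠ 0 := by exact_mod_cast hn
          positivity
        nlinarith [sq_nonneg x]
    · rintro rfl; ring
  rw [hset, Set.ncard_singleton] at h
  exact h.trans (by norm_num)

/-- **`rank A_n(ℚ) = rank E_n(ℚ)`** (isogeny invariance of the Mordell–Weil rank). [cite: MilneADT2006, proof of Thm. I.7.3 (p. 97)]
[cite: SilvermanAEC2009, III.6.2] -/
theorem mordellWeilRank_partner (hn : n ≠ 0) :
    haveI := isElliptic_congruentNumberCurve hn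
    (congruentNumberCurve n).twoIsogenyCodomain.mordellWeilRank = (congruentNumberCurve n).mordellWeilRank := by
  haveI := isElliptic_congruentNumberCurve hn
  exact ((congruentNumberCurve n).isIsogenous_twoIsogenyCodomain).mordellWeilRank_eq.symm

/-- **`#Sel₂(A_n/ℚ) = 2^{rank E_n(ℚ)} · 2 · #Ш(A_n/ℚ)[2]`** — the exact `2`-descent count (Silverman X.4.2) for the partner, with
`#A_n(ℚ)[2] = 2` and `rank A_n = rank E_n` fed in. [cite: SilvermanAEC2009, Thm. X.4.2] -/
theorem natCard_selmerTwo_partner (hn : n ≠ 0) :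
    haveI := isElliptic_congruentNumberCurve hn
    Nat.card ((congruentNumberCurve n).twoIsogenyCodomain.selmerGroup 2) =
      2 ^ (congruentNumberCurve n).mordellWeilRank * 2 *
        Nat.card (AddSubgroup.torsionBy (congruentNumberCurve n).twoIsogenyCodomain.sha (2 : ℤ)) := by
  haveI := isElliptic_congruentNumberCurve hn
  have h := (congruentNumberCurve n).twoIsogenyCodomain.pow_mordellWeilRank_mul_natCard_torsionBy_mul_natCard_shaTorsionBy_eq
    (n := 2) two_ne_zero
  simp only [Nat.cast_ofNat] at h
  rw [mordellWeilRank_partner hn,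
    natCard_torsionBy_two_partner hn (inst := fun a b => Classical.propDecidable (a = b))] at h
  exact h.symm

/-- **`Ш(A_n)[2] = 0` (elementwise) ⟺ `#Ш(A_n)[2] = 1`** (no finiteness needed: `Nat.card = 1` iff the `2`-torsion subgroup is a singleton).
[folklore] -/
theorem partner_sha_two_trivial_iff_natCard (hn : n ≠ 0) :
    haveI := isElliptic_congruentNumberCurve hn
    (∀ c ∈ (congruentNumberCurve n).twoIsogenyCodomain.sha, 2 • c = 0 → c = 0) ↔
      Nat.card (AddSubgroup.torsionBy (congruentNumberCurve n).twoIsogenyCodomain.sha (2 : ℤ)) = 1 := by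
  haveI := isElliptic_congruentNumberCurve hn
  set S := (congruentNumberCurve n).twoIsogenyCodomain.sha with hS
  rw [Nat.card_eq_one_iff_unique]
  constructor
  · intro h
    refine ⟨⟨fun x y => ?_⟩, ⟨0⟩⟩
    have hx0 : ∀ z : AddSubgroup.torsionBy S (2 : ℤ), z = 0 := by
      intro z
      have hz : (2 : ℤ) • (z : S) = 0 := (Submodule.mem_torsionBy_iff _ _).mp z.2
      have hval : (((2 : ℤ) • (z : S) : S) : (congruentNumberCurve n).twoIsogenyCodomain.galH1) =
          ((0 : S) : (congruentNumberCurve n).twoIsogenyCodomain.galH1) := congrArg Subtype.val hz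
      rw [AddSubgroupClass.coe_zsmul, ZeroMemClass.coe_zero, two_zsmul] at hval
      have hz' : 2 • (((z : S) : S) : (congruentNumberCurve n).twoIsogenyCodomain.galH1) = 0 := by
        rw [two_nsmul]; exact hval
      have := h _ (z : S).2 hz'
      exact Subtype.ext (Subtype.ext this)
    rw [hx0 x, hx0 y]
  · rintro ⟨hsub, -⟩ c hc h2c
    have hmem : (⟨c, hc⟩ : S) ∈ AddSubgroup.torsionBy S (2 : ℤ) := by
      refine (Submodule.mem_torsionBy_iff _ _).mpr (Subtype.ext ?_)
      rw [AddSubgroupClass.coe_zsmul, ZeroMemClass.coe_zero, two_zsmul]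
      rw [two_nsmul] at h2c
      exact h2c
    have h0 : (⟨⟨c, hc⟩, hmem⟩ : AddSubgroup.torsionBy S (2 : ℤ)) = 0 := Subsingleton.elim _ _
    exact congrArg (fun z : AddSubgroup.torsionBy S (2 : ℤ) => ((z : S) : (congruentNumberCurve n).twoIsogenyCodomain.galH1)) h0

/-- **THE DICTIONARY: on the rank-one leaf, `Ш(A_n)[2] = 0 ⟺ #Sel₂(A_n/ℚ) = 4`** (square-free `n`, `rank E_n(ℚ) = 1`; i.e. `dim_𝔽₂ Sel₂(A_n/ℚ) = 2`,
the census column of cruxlead g15). [cite: SilvermanAEC2009, Thm. X.4.2] [cite: TianYuanZhang2017, §1 (A_n)] -/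
theorem partner_sha_two_trivial_iff_natCard_selmerTwo (hsq : Squarefree n)
    (hr : haveI := isElliptic_congruentNumberCurve hsq.ne_zero; (congruentNumberCurve n).mordellWeilRank = 1) :
    haveI := isElliptic_congruentNumberCurve hsq.ne_zero
    (∀ c ∈ (congruentNumberCurve n).twoIsogenyCodomain.sha, 2 • c = 0 → c = 0) ↔
      Nat.card ((congruentNumberCurve n).twoIsogenyCodomain.selmerGroup 2) = 4 := by
  have hn := hsq.ne_zero
  haveI := isElliptic_congruentNumberCurve hn
  rw [partner_sha_two_trivial_iff_natCard hn, natCard_selmerTwo_partner hn, hr]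
  constructor
  · intro h; rw [h]; norm_num
  · intro h; omega

/-! ## §18 The HEADLINE on R1 and R2 in the currency `#Sel₂(A_n/ℚ) = 4` -/

/-- **T3 in Selmer currency** (no Cassels–Tate): square-free `n`, `rank E_n(ℚ) = 1`, `#Sel₂(E_n) = 2⁵`, `dim S'(0,−n²) = 2` (both odd two-prime
sectors), `#Sel₄(E_n) ≠ 2⁶` ⟹ `#Sel₂(A_n/ℚ) ≠ 4` (outside the jump-one class the partner's `2`-Selmer group is bigger).
[cite: SilvermanAEC2009, Thm. X.4.2, proof of Prop. X.6.2(c)] -/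
theorem natCard_selmerTwo_partner_ne_four_of_not_selmerFour (hsq : Squarefree n)
    (hr : haveI := isElliptic_congruentNumberCurve hsq.ne_zero; (congruentNumberCurve n).mordellWeilRank = 1)
    (h₂ : haveI := isElliptic_congruentNumberCurve hsq.ne_zero; Nat.card ((congruentNumberCurve n).selmerGroup 2) = 2 ^ 5)
    (hS' : twoIsogenySelmerRank' 0 (-((n : ℤ) ^ 2)) = 2)
    (h₄ : haveI := isElliptic_congruentNumberCurve hsq.ne_zero; Nat.card ((congruentNumberCurve n).selmerGroup 4) ≠ 2 ^ 6) :
    haveI := isElliptic_congruentNumberCurve hsq.ne_zero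
    Nat.card ((congruentNumberCurve n).twoIsogenyCodomain.selmerGroup 2) ≠ 4 := by
  haveI := isElliptic_congruentNumberCurve hsq.ne_zero
  intro h4
  have hA := (partner_sha_two_trivial_iff_natCard_selmerTwo hsq hr).mpr h4
  exact partner_sha_two_ne_of_not_selmerFour hsq hr h₂ hS' h₄ hA

end Count

section Sectors

variable {l m q : ℕ} [hlp : Fact l.Prime] [hmp : Fact m.Prime] [hqp : Fact q.Prime]

/-- **HEADLINE ON R1, SELMER CURRENCY.** Primes `l ≡ 1 (mod 8)`, `m ≡ 5 (mod 8)`, `(l/m) = (m/l) = 1`, `ord_{s=1} L(E_{lm}, s) = 1`, `#Sel₂(E_{lm}) = 2⁵`,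
granted GZK and the functorial Cassels–Tate pairing: **`#Sel₂(A_{lm}/ℚ) = 4 ⟺ ρ(lm) ≠ 0 ∧ #Sel₄(E_{lm}) = 2⁶`**.
[cite: MilneADT2006, Ch. I Thm. 6.13(a)] [cite: Darmon2004, Thm. 3.22] [cite: SilvermanAEC2009, Thm. X.4.2] [cite: TianYuanZhang2017, §1 (ρ(n))] -/
theorem natCard_selmerTwo_partner_eq_four_iff_R1 (hGZK : rank_eq_analyticRank_of_analyticRank_le_one)
    (hCT : exists_casselsTate_pairing_adjoint ℚ) (hl8 : l % 8 = 1) (hm8 : m % 8 = 5)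
    (hlm : IsSquare ((l : ℤ) : ZMod m)) (hml : IsSquare ((m : ℤ) : ZMod l))
    (hr1 : haveI := isElliptic_congruentNumberCurve (Nat.mul_ne_zero hlp.out.ne_zero hmp.out.ne_zero);
      (congruentNumberCurve (l * m)).analyticRank = 1)
    (h₂ : haveI := isElliptic_congruentNumberCurve (Nat.mul_ne_zero hlp.out.ne_zero hmp.out.ne_zero);
      Nat.card ((congruentNumberCurve (l * m)).selmerGroup 2) = 2 ^ 5) :
    haveI := isElliptic_congruentNumberCurve (Nat.mul_ne_zero hlp.out.ne_zero hmp.out.ne_zero)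
    Nat.card ((congruentNumberCurve (l * m)).twoIsogenyCodomain.selmerGroup 2) = 4 ↔
      ((rhoSubgroup (l * m)).index ≠ 1 ∧ Nat.card ((congruentNumberCurve (l * m)).selmerGroup 4) = 2 ^ 6) := by
  have hlm_ne : l ≠ m := by rintro rfl; omega
  obtain ⟨hsq, -⟩ := squarefree_and_one_lt_R2 (l := l) (q := m) hlm_ne
  haveI := isElliptic_congruentNumberCurve hsq.ne_zero
  have hrank : (congruentNumberCurve (l * m)).mordellWeilRank = 1 := (hGZK _ hr1.le).1.trans hr1
  rw [← partner_sha_two_trivial_iff_natCard_selmerTwo hsq hrank]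
  exact partner_sha_two_eq_bot_iff_R1 hGZK hCT hl8 hm8 hlm hml hr1 h₂

/-- **HEADLINE ON R2, SELMER CURRENCY.** Primes `l ≡ 1 (mod 8)`, `q ≡ 7 (mod 8)`, `(l/q) = (q/l) = 1`, `ord_{s=1} L(E_{lq}, s) = 1`, `#Sel₂(E_{lq}) = 2⁵`,
granted GZK and the functorial Cassels–Tate pairing: **`#Sel₂(A_{lq}/ℚ) = 4 ⟺ ρ(lq) ≠ 0 ∧ #Sel₄(E_{lq}) = 2⁶`** — cruxlead g15's census sentence
«`dim Sel₂(A_{lq}/ℚ) = 2 ⟺ ρ = 1` on G» as a theorem. [cite: MilneADT2006, Ch. I Thm. 6.13(a)] [cite: Darmon2004, Thm. 3.22]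
[cite: SilvermanAEC2009, Thm. X.4.2] [cite: TianYuanZhang2017, §1 (ρ(n))] -/
theorem natCard_selmerTwo_partner_eq_four_iff_R2 (hGZK : rank_eq_analyticRank_of_analyticRank_le_one)
    (hCT : exists_casselsTate_pairing_adjoint ℚ) (hl8 : l % 8 = 1) (hq8 : q % 8 = 7)
    (hlq : IsSquare ((l : ℤ) : ZMod q)) (hql : IsSquare ((q : ℤ) : ZMod l))
    (hr1 : haveI := isElliptic_congruentNumberCurve (Nat.mul_ne_zero hlp.out.ne_zero hqp.out.ne_zero);
      (congruentNumberCurve (l * q)).analyticRank = 1)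
    (h₂ : haveI := isElliptic_congruentNumberCurve (Nat.mul_ne_zero hlp.out.ne_zero hqp.out.ne_zero);
      Nat.card ((congruentNumberCurve (l * q)).selmerGroup 2) = 2 ^ 5) :
    haveI := isElliptic_congruentNumberCurve (Nat.mul_ne_zero hlp.out.ne_zero hqp.out.ne_zero)
    Nat.card ((congruentNumberCurve (l * q)).twoIsogenyCodomain.selmerGroup 2) = 4 ↔
      ((rhoSubgroup (l * q)).index ≠ 1 ∧ Nat.card ((congruentNumberCurve (l * q)).selmerGroup 4) = 2 ^ 6) := by
  have hlq_ne : l ≠ q := by rintro rfl; omega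
  obtain ⟨hsq, -⟩ := squarefree_and_one_lt_R2 (l := l) (q := q) hlq_ne
  haveI := isElliptic_congruentNumberCurve hsq.ne_zero
  have hrank : (congruentNumberCurve (l * q)).mordellWeilRank = 1 := (hGZK _ hr1.le).1.trans hr1
  rw [← partner_sha_two_trivial_iff_natCard_selmerTwo hsq hrank]
  exact partner_sha_two_eq_bot_iff_R2 hGZK hCT hl8 hq8 hlq hql hr1 h₂

end Sectors

end Summit.BirchSwinnertonDyer.PrintCf2.PartnerSha

end
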